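import Summits.QuantumFields.BalabanUV.Beta.FP.BiVertexDressSym
import Summits.QuantumFields.BalabanUV.Beta.SecondOrderRemainderTables
import Summits.QuantumFields.BalabanUV.Beta.SymmetrisedStepJetsUnits
import Summits.QuantumFields.BalabanUV.Beta.RecursiveWSlot
import Summits.QuantumFields.BalabanUV.Beta.GAN24.Lin4Additive

/-!
# `BalabanUV.Beta.FP.BiVertexDressSymLiteral` — road «FP» for binder row D1, `RESIDUAL-FP.md` §9 ROW #14 literal side «COPROJ₂-SYM» FILE 2 (owner item,
# journal 2026-08-21T08:42Z, part (3)): THE LITERAL's SECOND-ORDER SLOT IN THE LEFT PLACEMENT IS A BI-VERTEX THROUGH THE UNDRESSED LEG PLUS A DRESSED REST —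
# `(JsB12Sym … j).W μ y ν y′ = vertex2OfK (KInvStep Lc j) Lc (½•(T̂2_j + T̂2_jᵀ)) μ y ν y′ + Π̂ (½•(R_j μyνy′ + R_j νy′μy)) Π̂ᵀ` — NO symmetry letter on the tables

HONEST DEPENDENCY (page 1, mandatory): continuum YM on T⁴ ⇐ BetaPertH ∧ nine spine estimates (0/9 proved); BetaPertH ⇐ (D1) ∧ (D4) ∧ CAP+tail;
G-an2-4 gates asym, D1 and NE2/3/4.  HONEST FRAMING (cell contract, verbatim): «discharging `BetaPertH` makes Bałaban's UV stability UNCONDITIONAL —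
a real constructive-QFT result; it is NOT the continuum limit and NOT the Clay problem.»  THIS MODULE DISCHARGES NOTHING of the wall: [folklore] bookkeeping
over FILE 1 (`FP/BiVertexDressSym.dressKSymAt_vertex2OfK_coDress`), an1's `KernelWardSwap.vertex2OfK_swap_eq_transpose`, `SecondOrderRemainderTables.vertex2OfK_add_of_bdd`,
gan24's `Lin4Additive.vertex2OfK_smul`; an2's `dressKSymAt_mul_left`∕`dressKSymAt_finset_sum`, `JsB12Sym0_W_eq`, `W2SymOfK`∕`W2OfK_apply`, `RecursiveWSlot.T2RecOf_loc`, `decays_Gsym`∕`decays_KInvStep`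
BY NAME.  No `def` (the twice-projected dressed bi-table and the rest are explicit lambdas; FILE 1's `_congr` form serves named objects), no `def … : Prop`, nothing cited,
0 sorry.  0∕4 row-D1 binders; NOT X1-S₂ rates, NOT the convergence of the rest ((G8)∕(G-mix-W)), NOT (ASYMP), NOT D1, NOT BetaPertH, NOT continuum, NOT Clay.
«not in print; our bookkeeping».

ABSOLUTE RULE (cell charter, verbatim): «No internally-minted statement may enter as a cited fact. Every hypothesis is either kernel-proved in this package or a
verbatim quotation of a PUBLISHED theorem with page reference. The manuscript(s) under audit are NOT citable for their own disputed steps — they are the thing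
under adjudication; programme-internal (2001/route/tribunal) claims are never citable.»

CONTENT (in-block root `ρ = toSite r`, `[NeZero N]`; `D := dressKSymAt ρ N`, `G := coDressKSymAt ρ N K`; for a bi-table `S₂`: `Ŝ₂` = the twice-projected dressed
bi-table of FILE 1, `Ŝ₂ᵀ κ u κ′ u′ := Ŝ₂ κ′ u′ κ u`).
* §1 [folklore] `dressKSymAt_add'` (entrywise additivity of the dressing, unconditional: an2's `dressKSymAt_finset_sum` over `Fin 2`); `abs_hat_le` (the entries of `Ŝ₂` are
  bounded: `locStencil_slotOneProj` → an2's `locStencil_coProjSymAtK` → `locStencil_dressKSymAt`); **`dressKSymAt_halfSum_vertex2OfK_coDress`** — for `Decays K C δ`,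
  `LocStencil₂ S₂ C₂ m`: `D (½•(vertex2OfK G N S₂ μ y ν y′ + vertex2OfK G N S₂ ν y′ μ y)) = vertex2OfK K N (½•(Ŝ₂ + Ŝ₂ᵀ)) μ y ν y′` — FILE 1 twice, an1's transpose
  lemma on the swapped bi-vertex (NO slot-symmetry of `S₂` assumed), additivity∕homogeneity of the bi-vertex in a bounded bi-table.
* §2 [folklore] **`dressKSymAt_W2SymOfK_coDress`** — the same for an2's symmetrised second-order carrier: `D (W2SymOfK G N S M S₂ M₂ μ y ν y′) =
  vertex2OfK K N (½•(Ŝ₂ + Ŝ₂ᵀ)) μ y ν y′ + D (½•(R μ y ν y′ + R ν y′ μ y))`, `R μ y ν y′ := mixOfK G N M₂ μ y ν y′ + mixOfK G N M₂ ν y′ μ y + dM (K2OfK G N S M ν y′) N S M μ y`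
  (the non-bi-vertex pieces of `W2OfK_apply`, both orders) — with a hypothesis `hG : G = coDressKSymAt ρ N K` so that named co-dressed legs (`Gsym Lc j`) plug in.
* §3 [our object] THE LITERAL (d = 3, `Odd Lc`, centred root, `K := KInvStep Lc j`, `G = Gsym Lc j` by `Gsym_apply`): **`JsB12Sym_W_eq_vertex2OfK_add_dressed_rest`** —
  `(JsB12Sym hLc Ncol tabs cΛ cB j).W μ y ν y′ = vertex2OfK (KInvStep Lc j) Lc (½•(T̂2_j + T̂2_jᵀ)) μ y ν y′ + D (½•(R_j μ y ν y′ + R_j ν y′ μ y))` with `T2_j` the literal's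
  bi-stencil `T2RecOf 3 Lc (Gsym Lc) (SpureSymOf …) tabs.M (Lc⁸) cB ((8Ncol²)⁻¹•wsym22 Ncol) tabs.vh₂S tabs.mixFF j` (its `LocStencil₂` letter from an2's
  `RecursiveWSlot.T2RecOf_loc` on the table record's letters) — the `hsplit` SHAPE of `RoadEndLeft` §5 at finite `j`: bi-vertex through the UNDRESSED leg + rest;
  family form `…_fam`; `unitW_add'`; **`unitW_JsB12Sym_W_eq`** — the rescaled member-`j` shape `unitW sf sm (JsB12Sym … j).W = vertex2OfK (unitK sf sm (KInvStep Lc j)) Lc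
  (unitS₂ sf sm (½•(T̂2_j + T̂2_jᵀ))) + unitW sf sm X_j` (the owner's `BiVertexLimit.unitW_vertex2OfK`), which `BiVertexLimit.limTabOf_split_of_rates` consumes (rates EXT).
Provenance: D1 formalisation swarm LEAF PROVER 06, unit b2b-balaban-beta-d1-formalise-leaf-06 gen 11, 2026-08-21; owner item «COPROJ₂-SYM» (journal l.29341) part (3).
-/

noncomputable section

namespace Summit.QuantumFields.BalabanUV.Beta.FP.BiVertexDressSymLiteral

open Finset
open scoped BigOperators
open Literature.MathematicalPhysics.QuantumFieldTheory
open Literature.MathematicalPhysics.QuantumFieldTheory.Balaban1983to89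
open Literature.MathematicalPhysics.QuantumFieldTheory.Balaban1983to89.Beta
open B12Sec2to5 (l1 l1_nonneg)
open ExpKernelCalculus (MKer Decays BiLoc Zl Zl_nonneg)
open AffineAveraging (Form1 box toSite)
open AveragingContoursRooted (ctr ctrOff ctrOff_mem_box)
open OneStepResolventKernel (Fib wsum LocStencil decays_mono)
open OneStepKernelFamily (colH vertexOfK KInvStep decays_KInvStep)
open BalabanCompositeJets (LocStencil₂)
open SecondOrderResponse (vertex2OfK mixOfK dM K2OfK W2OfK W2SymOfK W2OfK_apply)
open BalabanStepW2 (M2Of)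
open WilsonVertex2Sym (wsym22)
open Summit.QuantumFields.BalabanUV.Beta.AxialDressingRooted (cube cKb cKb' one_le_of_neZero)
open Summit.QuantumFields.BalabanUV.Beta.SymmetrisedDressingKernel (dressKSymAt coDressKSymAt)
open Summit.QuantumFields.BalabanUV.Beta.SymmetrisedDressingDress (coProjSymAtK locStencil_coProjSymAtK locStencil_dressKSymAt dressSymAt)
open Summit.QuantumFields.BalabanUV.Beta.SymmetrisedDressingLinear (dressKSymAt_mul_left dressKSymAt_finset_sum)
open Summit.QuantumFields.BalabanUV.Beta.SecondOrderRemainderTables (vertex2OfK_add_of_bdd)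
open Summit.QuantumFields.BalabanUV.Beta.SecondOrderUnits (vertexOfK_smul_table unitS₂)
open Summit.QuantumFields.BalabanUV.Beta.HessKerDressedUnits (unitK unitW unitW_apply)
open Summit.QuantumFields.BalabanUV.Beta.FP.BiVertexLimit (unitW_vertex2OfK)
open Summit.QuantumFields.BalabanUV.Beta.KernelWardSwap (vertex2OfK_swap_eq_transpose)
open Summit.QuantumFields.BalabanUV.Beta.GAN24.Lin4Additive (vertex2OfK_smul)
open Summit.QuantumFields.BalabanUV.Beta.SpineRooted (T2RecOf T2RecOf_loc)
open Summit.QuantumFields.BalabanUV.Beta.SymmetrisedStepJets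
open Summit.QuantumFields.BalabanUV.Beta.SymmetrisedStepJetsUnits (JsB12Sym0_W_eq)
open Summit.QuantumFields.BalabanUV.Beta.FP.BiVertexDressSym (locStencil_slotOneProj dressKSymAt_vertex2OfK_coDress)

variable {d : ℕ}

/-! ## §1 The symmetrised bi-vertex through the co-dressed leg, dressed -/

section Generic

variable {N : ℕ} {r : Fin (d + 1) → ℕ}

/-- [folklore] The block-mean dressing is additive, entry by entry, unconditionally (an2's `dressKSymAt_finset_sum` over `Fin 2`). -/
theorem dressKSymAt_add' (ρ : Fin (d + 1) → ℤ) (N : ℕ) (K L : MKer (d + 1) (Fib d)) (x z : Fin (d + 1) → ℤ) (a b : Fib d) :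
    dressKSymAt ρ N (K + L) x z a b = dressKSymAt ρ N K x z a b + dressKSymAt ρ N L x z a b := by
  have h := dressKSymAt_finset_sum ρ N (Finset.univ : Finset (Fin 2)) ![K, L] x z a b
  simp only [Fin.sum_univ_two, Matrix.cons_val_zero, Matrix.cons_val_one] at h
  exact h

/-- [folklore] **THE ENTRIES OF THE TWICE-PROJECTED DRESSED BI-TABLE ARE BOUNDED** (in-block root, `LocStencil₂ S₂ C₂ m`, `0 ≤ m`): by the local-stencil letter
of `Ŝ₂ κ u` (`locStencil_slotOneProj` → an2's `locStencil_coProjSymAtK` → `locStencil_dressKSymAt`, rate `m/2`) and `e^{−…} ≤ 1`. -/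
theorem abs_hat_le (hN : 1 ≤ N) (hr : r ∈ box (d + 1) N)
    {S₂ : Fin (d + 1) → (Fin (d + 1) → ℤ) → Fin (d + 1) → (Fin (d + 1) → ℤ) → MKer (d + 1) (Fib d)} {C₂ m : ℝ}
    (hS₂ : LocStencil₂ S₂ C₂ m) (hm : 0 ≤ m) (κ : Fin (d + 1)) (u : Fin (d + 1) → ℤ) (κ' : Fin (d + 1)) (u' x z : Fin (d + 1) → ℤ)
    (a b : Fib d) :
    |dressKSymAt (toSite r) N (coProjSymAtK (toSite r) N
        (fun κ'' u'' => coProjSymAtK (toSite r) N (fun β w => S₂ β w κ'' u'') κ u) κ' u') x z a b| ≤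
      cKb d N (m / 2) * (cKb d N (m / 2) * (cKb' d N (m / 2) *
        (((cube (d + 1) N).card : ℝ) * ((d + 1 : ℕ) * ((1 + 4 * (((d : ℝ) + 1) * N)) * C₂))))) := by
  have hm2 : 0 ≤ m / 2 := by linarith
  have hL := locStencil_dressKSymAt hN hr (locStencil_coProjSymAtK hN hr (locStencil_slotOneProj hN hr hS₂ hm κ u) hm2) hm2 κ' u' x z a b
  refine hL.trans ?_
  have hC := (locStencil_dressKSymAt hN hr (locStencil_coProjSymAtK hN hr (locStencil_slotOneProj hN hr hS₂ hm κ u) hm2) hm2 κ' u').nonneg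
    (Sum.inl 0)
  have he : Real.exp (-(m / 2) * (l1 (x - u') + l1 (z - u'))) ≤ 1 := by
    rw [Real.exp_le_one_iff]; nlinarith [l1_nonneg (x - u'), l1_nonneg (z - u')]
  exact (mul_le_of_le_one_right hC he)

/-- [folklore] **THE DRESSED SYMMETRISED BI-VERTEX THROUGH THE CO-DRESSED LEG IS THE BI-VERTEX THROUGH THE UNDRESSED LEG OF THE SYMMETRISED TWICE-PROJECTED
DRESSED BI-TABLE** (in-block root, `[NeZero N]`, `Decays K C δ` with `0 < δ`, `LocStencil₂ S₂ C₂ m` with `0 < m`; NO slot-symmetry of `S₂` assumed):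
`Π̂ (½•(vertex2OfK G N S₂ μ y ν y′ + vertex2OfK G N S₂ ν y′ μ y)) Π̂ᵀ = vertex2OfK K N (½•(Ŝ₂ + Ŝ₂ᵀ)) μ y ν y′`
(FILE 1 on both orders; an1's `vertex2OfK_swap_eq_transpose` on the swapped one; `vertex2OfK_add_of_bdd` + homogeneity). -/
theorem dressKSymAt_halfSum_vertex2OfK_coDress [NeZero N] (hr : r ∈ box (d + 1) N) {K : MKer (d + 1) (Fib d)} {C δ : ℝ}
    (hK : Decays K C δ) (hδ : 0 < δ)
    {S₂ : Fin (d + 1) → (Fin (d + 1) → ℤ) → Fin (d + 1) → (Fin (d + 1) → ℤ) → MKer (d + 1) (Fib d)} {C₂ m : ℝ}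
    (hS₂ : LocStencil₂ S₂ C₂ m) (hm : 0 < m) (μ : Fin (d + 1)) (y : Fin (d + 1) → ℤ) (ν : Fin (d + 1)) (y' : Fin (d + 1) → ℤ) :
    dressKSymAt (toSite r) N ((1 / 2 : ℝ) • (vertex2OfK (coDressKSymAt (toSite r) N K) N S₂ μ y ν y' +
        vertex2OfK (coDressKSymAt (toSite r) N K) N S₂ ν y' μ y)) =
      vertex2OfK K N ((1 / 2 : ℝ) •
        ((fun κ u κ' u' => dressKSymAt (toSite r) N
            (coProjSymAtK (toSite r) N (fun κ'' u'' => coProjSymAtK (toSite r) N (fun β w => S₂ β w κ'' u'') κ u) κ' u')) +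
          (fun κ u κ' u' => dressKSymAt (toSite r) N
            (coProjSymAtK (toSite r) N (fun κ'' u'' => coProjSymAtK (toSite r) N (fun β w => S₂ β w κ'' u'') κ' u') κ u)))) μ y ν y' := by
  have hN : 1 ≤ N := one_le_of_neZero N
  set Sh : Fin (d + 1) → (Fin (d + 1) → ℤ) → Fin (d + 1) → (Fin (d + 1) → ℤ) → MKer (d + 1) (Fib d) :=
    fun κ u κ' u' => dressKSymAt (toSite r) N
      (coProjSymAtK (toSite r) N (fun κ'' u'' => coProjSymAtK (toSite r) N (fun β w => S₂ β w κ'' u'') κ u) κ' u') with hSh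
  have hB := fun κ u κ' u' x z a b => abs_hat_le hN hr hS₂ hm.le κ u κ' u' x z a b
  have hBt : ∀ κ u κ' u' x z a b, |(fun κ u κ' u' => Sh κ' u' κ u) κ u κ' u' x z a b| ≤ _ :=
    fun κ u κ' u' x z a b => hB κ' u' κ u x z a b
  have hKex : ∃ δ C : ℝ, 0 < δ ∧ 0 ≤ C ∧ Decays K C δ := ⟨δ, C, hδ, hK.nonneg (Sum.inl 0), hK⟩
  have e1 := dressKSymAt_vertex2OfK_coDress hN hr hK hδ hS₂ hm μ y ν y'
  have e2 := dressKSymAt_vertex2OfK_coDress hN hr hK hδ hS₂ hm ν y' μ y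
  have e3 : vertex2OfK K N Sh ν y' μ y = vertex2OfK K N (fun κ u κ' u' => Sh κ' u' κ u) μ y ν y' :=
    vertex2OfK_swap_eq_transpose hKex hB μ y ν y'
  have e4 : vertex2OfK K N ((1 / 2 : ℝ) • (Sh + fun κ u κ' u' => Sh κ' u' κ u)) μ y ν y' =
      (1 / 2 : ℝ) • (vertex2OfK K N Sh μ y ν y' + vertex2OfK K N (fun κ u κ' u' => Sh κ' u' κ u) μ y ν y') := by
    rw [vertex2OfK_smul, ← vertex2OfK_add_of_bdd hKex hB hBt μ y ν y']
    rfl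
  rw [e4]
  funext x z a b
  show dressKSymAt (toSite r) N (fun x z a b => (1 / 2 : ℝ) * (vertex2OfK (coDressKSymAt (toSite r) N K) N S₂ μ y ν y' +
      vertex2OfK (coDressKSymAt (toSite r) N K) N S₂ ν y' μ y) x z a b) x z a b = _
  rw [dressKSymAt_mul_left, dressKSymAt_add', e1, e2, e3]
  rfl

end Generic

/-! ## §2 The dressed symmetrised second-order carrier through the co-dressed leg -/

section Carrier

variable {N : ℕ} [NeZero N] {r : Fin (d + 1) → ℕ}

/-- [folklore] **THE DRESSED `W2SymOfK` THROUGH THE CO-DRESSED LEG = BI-VERTEX THROUGH THE UNDRESSED LEG + DRESSED REST** (in-block root; `G` any kernel EQUAL to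
`Π̂ᵀ K Π̂` — hypothesis `hG`, so named co-dressed legs plug in; `Decays K C δ`, `LocStencil₂ S₂ C₂ m`; the tables `S`, `M`, `M₂` arbitrary):
`Π̂ (W2SymOfK G N S M S₂ M₂ μ y ν y′) Π̂ᵀ = vertex2OfK K N (½•(Ŝ₂ + Ŝ₂ᵀ)) μ y ν y′ + Π̂ (½•(R μ y ν y′ + R ν y′ μ y)) Π̂ᵀ`,
`R μ y ν y′ := mixOfK G N M₂ μ y ν y′ + mixOfK G N M₂ ν y′ μ y + dM (K2OfK G N S M ν y′) N S M μ y` (the non-bi-vertex pieces of an2's `W2OfK_apply`). -/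
theorem dressKSymAt_W2SymOfK_coDress (hr : r ∈ box (d + 1) N) {K G : MKer (d + 1) (Fib d)} {C δ : ℝ}
    (hK : Decays K C δ) (hδ : 0 < δ) (hG : G = coDressKSymAt (toSite r) N K)
    (S M : Fin (d + 1) → (Fin (d + 1) → ℤ) → MKer (d + 1) (Fib d))
    {S₂ : Fin (d + 1) → (Fin (d + 1) → ℤ) → Fin (d + 1) → (Fin (d + 1) → ℤ) → MKer (d + 1) (Fib d)} {C₂ m : ℝ}
    (hS₂ : LocStencil₂ S₂ C₂ m) (hm : 0 < m)
    (M₂ : Fin (d + 1) → (Fin (d + 1) → ℤ) → Fin (d + 1) → (Fin (d + 1) → ℤ) → MKer (d + 1) (Fib d))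
    (μ : Fin (d + 1)) (y : Fin (d + 1) → ℤ) (ν : Fin (d + 1)) (y' : Fin (d + 1) → ℤ) :
    dressKSymAt (toSite r) N (W2SymOfK G N S M S₂ M₂ μ y ν y') =
      vertex2OfK K N ((1 / 2 : ℝ) •
        ((fun κ u κ' u' => dressKSymAt (toSite r) N
            (coProjSymAtK (toSite r) N (fun κ'' u'' => coProjSymAtK (toSite r) N (fun β w => S₂ β w κ'' u'') κ u) κ' u')) +
          (fun κ u κ' u' => dressKSymAt (toSite r) N
            (coProjSymAtK (toSite r) N (fun κ'' u'' => coProjSymAtK (toSite r) N (fun β w => S₂ β w κ'' u'') κ' u') κ u)))) μ y ν y' +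
      dressKSymAt (toSite r) N ((1 / 2 : ℝ) •
        ((mixOfK G N M₂ μ y ν y' + mixOfK G N M₂ ν y' μ y + dM (K2OfK G N S M ν y') N S M μ y) +
          (mixOfK G N M₂ ν y' μ y + mixOfK G N M₂ μ y ν y' + dM (K2OfK G N S M μ y) N S M ν y'))) := by
  -- regroup the carrier: ½•(vertex pieces) + ½•(rest pieces)
  have e0 : W2SymOfK G N S M S₂ M₂ μ y ν y' =
      (1 / 2 : ℝ) • (vertex2OfK G N S₂ μ y ν y' + vertex2OfK G N S₂ ν y' μ y) +
        (1 / 2 : ℝ) • ((mixOfK G N M₂ μ y ν y' + mixOfK G N M₂ ν y' μ y + dM (K2OfK G N S M ν y') N S M μ y) +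
          (mixOfK G N M₂ ν y' μ y + mixOfK G N M₂ μ y ν y' + dM (K2OfK G N S M μ y) N S M ν y')) := by
    unfold SecondOrderResponse.W2SymOfK
    rw [W2OfK_apply, W2OfK_apply]
    funext x z a b
    simp only [Pi.add_apply, Pi.smul_apply, smul_eq_mul]
    ring
  rw [e0]
  subst hG
  have h1 := dressKSymAt_halfSum_vertex2OfK_coDress hr hK hδ hS₂ hm μ y ν y'
  funext x z a b
  simp only [Pi.add_apply]
  rw [dressKSymAt_add', h1]

end Carrier

/-! ## §3 The literal of record: its second-order slot in the LEFT placement, at every finite `j` -/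

section Literal

variable {Lc : ℕ} [NeZero Lc] (hLc : Odd Lc) (Ncol : ℕ) (tabs : SymTables 3 Lc) (cΛ cB : ℝ)

/-- [folklore] The literal's bi-stencil `T2_j` is a `LocStencil₂` family at some positive rate (an2's `RecursiveWSlot.T2RecOf_loc` on the table record's letters
`hM`, `hB`, `hmix`, `decays_Gsym`, `locStencil_SpureSymOf`). -/
theorem locStencil₂_T2_literal (j : ℕ) :
    ∃ C δ : ℝ, 0 < δ ∧ LocStencil₂ (T2RecOf 3 Lc (Gsym Lc) (SpureSymOf tabs ((Lc : ℝ) ^ 4) (-((Lc : ℝ) ^ 8 / 2)) cΛ) tabs.M ((Lc : ℝ) ^ 8) cB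
      ((8 * (Ncol : ℝ) ^ 2)⁻¹ • wsym22 Ncol) tabs.vh₂S tabs.mixFF j) C δ :=
  T2RecOf_loc ((Lc : ℝ) ^ 8) cB ((8 * (Ncol : ℝ) ^ 2)⁻¹ • wsym22 Ncol) tabs.vh₂S tabs.mixFF (one_le_of_neZero Lc) (decays_Gsym Lc)
    (locStencil_SpureSymOf tabs ((Lc : ℝ) ^ 4) (-((Lc : ℝ) ^ 8 / 2)) cΛ) tabs.hM tabs.hB tabs.hmix j

/-- [our object] **THE LITERAL's SECOND-ORDER SLOT IN THE LEFT PLACEMENT, AT EVERY FINITE `j` — BI-VERTEX THROUGH THE UNDRESSED LEG + DRESSED REST** (d = 3,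
`Odd Lc`, centred root; NO symmetry letter on the tables).  With `T2_j` the literal's bi-stencil and `T̂2_j` its twice-projected dressed image (FILE 1's lambda at
`ρ_c`, `N := Lc`), `R_j μ y ν y′ := mixOfK (Gsym Lc j) Lc (M2Of … j) μ y ν y′ + mixOfK (Gsym Lc j) Lc (M2Of … j) ν y′ μ y + dM (K2OfK (Gsym Lc j) Lc Spure_j (tabs.M j) ν y′) Lc Spure_j (tabs.M j) μ y`:
`(JsB12Sym hLc Ncol tabs cΛ cB j).W μ y ν y′ = vertex2OfK (KInvStep Lc j) Lc (½•(T̂2_j + T̂2_jᵀ)) μ y ν y′ + Π̂ (½•(R_j μ y ν y′ + R_j ν y′ μ y)) Π̂ᵀ` — the finite-`j` SHAPE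
of `RoadEndLeft` §5's `hsplit` (`WPerfOf … = vertex2OfK (KPerf m) … + Wx m`) for the literal: the bi-vertex goes through the UNDRESSED leg `KInvStep Lc j`
(whose unit-rescaled limit is `KPerf … 1`, gan24 ✓), the dressing has moved into the bi-table.  (`dressSymAt_W` rfl, `JsB12Sym0_W_eq`, `Gsym_apply`, §2.) -/
theorem JsB12Sym_W_eq_vertex2OfK_add_dressed_rest (j : ℕ) (μ : Fin (3 + 1)) (y : Fin (3 + 1) → ℤ) (ν : Fin (3 + 1)) (y' : Fin (3 + 1) → ℤ) :
    (JsB12Sym hLc Ncol tabs cΛ cB j).W μ y ν y' =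
      vertex2OfK (KInvStep (d := 3) Lc j) Lc ((1 / 2 : ℝ) •
        ((fun κ u κ' u' => dressKSymAt (toSite (ctrOff (3 + 1) Lc)) Lc
            (coProjSymAtK (toSite (ctrOff (3 + 1) Lc)) Lc (fun κ'' u'' => coProjSymAtK (toSite (ctrOff (3 + 1) Lc)) Lc (fun β w =>
              T2RecOf 3 Lc (Gsym Lc) (SpureSymOf tabs ((Lc : ℝ) ^ 4) (-((Lc : ℝ) ^ 8 / 2)) cΛ) tabs.M ((Lc : ℝ) ^ 8) cB
                ((8 * (Ncol : ℝ) ^ 2)⁻¹ • wsym22 Ncol) tabs.vh₂S tabs.mixFF j β w κ'' u'') κ u) κ' u')) +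
          (fun κ u κ' u' => dressKSymAt (toSite (ctrOff (3 + 1) Lc)) Lc
            (coProjSymAtK (toSite (ctrOff (3 + 1) Lc)) Lc (fun κ'' u'' => coProjSymAtK (toSite (ctrOff (3 + 1) Lc)) Lc (fun β w =>
              T2RecOf 3 Lc (Gsym Lc) (SpureSymOf tabs ((Lc : ℝ) ^ 4) (-((Lc : ℝ) ^ 8 / 2)) cΛ) tabs.M ((Lc : ℝ) ^ 8) cB
                ((8 * (Ncol : ℝ) ^ 2)⁻¹ • wsym22 Ncol) tabs.vh₂S tabs.mixFF j β w κ'' u'') κ' u') κ u)))) μ y ν y' +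
      dressKSymAt (toSite (ctrOff (3 + 1) Lc)) Lc ((1 / 2 : ℝ) •
        ((mixOfK (Gsym (d := 3) Lc j) Lc (M2Of 3 Lc tabs.mixFF j) μ y ν y' + mixOfK (Gsym (d := 3) Lc j) Lc (M2Of 3 Lc tabs.mixFF j) ν y' μ y +
            dM (K2OfK (Gsym (d := 3) Lc j) Lc (SpureSymOf tabs ((Lc : ℝ) ^ 4) (-((Lc : ℝ) ^ 8 / 2)) cΛ j) (tabs.M j) ν y') Lc
              (SpureSymOf tabs ((Lc : ℝ) ^ 4) (-((Lc : ℝ) ^ 8 / 2)) cΛ j) (tabs.M j) μ y) +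
          (mixOfK (Gsym (d := 3) Lc j) Lc (M2Of 3 Lc tabs.mixFF j) ν y' μ y + mixOfK (Gsym (d := 3) Lc j) Lc (M2Of 3 Lc tabs.mixFF j) μ y ν y' +
            dM (K2OfK (Gsym (d := 3) Lc j) Lc (SpureSymOf tabs ((Lc : ℝ) ^ 4) (-((Lc : ℝ) ^ 8 / 2)) cΛ j) (tabs.M j) μ y) Lc
              (SpureSymOf tabs ((Lc : ℝ) ^ 4) (-((Lc : ℝ) ^ 8 / 2)) cΛ j) (tabs.M j) ν y'))) := by
  obtain ⟨δK, CK, hδK, -, hK⟩ := decays_KInvStep (Lc := Lc) (d := 3) j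
  obtain ⟨C₂, m, hm, hT⟩ := locStencil₂_T2_literal Ncol tabs cΛ cB j
  have eW : (JsB12Sym hLc Ncol tabs cΛ cB j).W μ y ν y' =
      dressKSymAt (toSite (ctrOff (3 + 1) Lc)) Lc ((JsB12Sym0 hLc Ncol tabs cΛ cB j).W μ y ν y') := rfl
  rw [eW, JsB12Sym0_W_eq]
  exact dressKSymAt_W2SymOfK_coDress (ctrOff_mem_box (one_le_of_neZero Lc)) hK hδK (Gsym_apply Lc j) _ _ hT hm _ μ y ν y'


/-- [folklore] Change of leg units is additive on second-order tables (pointwise `ring`). -/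
theorem unitW_add' {d' : ℕ} (sf sm : ℝ)
    (W W' : Fin (d' + 1) → (Fin (d' + 1) → ℤ) → Fin (d' + 1) → (Fin (d' + 1) → ℤ) → MKer (d' + 1) (Fib d')) :
    unitW sf sm (W + W') = unitW sf sm W + unitW sf sm W' := by
  funext μ y ν y' x z a b
  simp only [unitW_apply, Pi.add_apply]
  ring

/-- [our object] **THE SAME AS AN EQUALITY OF TABLE FAMILIES** (`funext`): `(JsB12Sym … j).W = vertex2OfK (KInvStep Lc j) Lc (½•(T̂2_j + T̂2_jᵀ)) + X_j`,
`X_j μ y ν y′ := Π̂ (½•(R_j μ y ν y′ + R_j ν y′ μ y)) Π̂ᵀ`. -/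
theorem JsB12Sym_W_eq_vertex2OfK_add_dressed_rest_fam (j : ℕ) :
    (JsB12Sym hLc Ncol tabs cΛ cB j).W =
      vertex2OfK (KInvStep (d := 3) Lc j) Lc ((1 / 2 : ℝ) •
        ((fun κ u κ' u' => dressKSymAt (toSite (ctrOff (3 + 1) Lc)) Lc
            (coProjSymAtK (toSite (ctrOff (3 + 1) Lc)) Lc (fun κ'' u'' => coProjSymAtK (toSite (ctrOff (3 + 1) Lc)) Lc (fun β w =>
              T2RecOf 3 Lc (Gsym Lc) (SpureSymOf tabs ((Lc : ℝ) ^ 4) (-((Lc : ℝ) ^ 8 / 2)) cΛ) tabs.M ((Lc : ℝ) ^ 8) cB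
                ((8 * (Ncol : ℝ) ^ 2)⁻¹ • wsym22 Ncol) tabs.vh₂S tabs.mixFF j β w κ'' u'') κ u) κ' u')) +
          (fun κ u κ' u' => dressKSymAt (toSite (ctrOff (3 + 1) Lc)) Lc
            (coProjSymAtK (toSite (ctrOff (3 + 1) Lc)) Lc (fun κ'' u'' => coProjSymAtK (toSite (ctrOff (3 + 1) Lc)) Lc (fun β w =>
              T2RecOf 3 Lc (Gsym Lc) (SpureSymOf tabs ((Lc : ℝ) ^ 4) (-((Lc : ℝ) ^ 8 / 2)) cΛ) tabs.M ((Lc : ℝ) ^ 8) cB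
                ((8 * (Ncol : ℝ) ^ 2)⁻¹ • wsym22 Ncol) tabs.vh₂S tabs.mixFF j β w κ'' u'') κ' u') κ u)))) +
      fun μ y ν y' => dressKSymAt (toSite (ctrOff (3 + 1) Lc)) Lc ((1 / 2 : ℝ) •
        ((mixOfK (Gsym (d := 3) Lc j) Lc (M2Of 3 Lc tabs.mixFF j) μ y ν y' + mixOfK (Gsym (d := 3) Lc j) Lc (M2Of 3 Lc tabs.mixFF j) ν y' μ y +
            dM (K2OfK (Gsym (d := 3) Lc j) Lc (SpureSymOf tabs ((Lc : ℝ) ^ 4) (-((Lc : ℝ) ^ 8 / 2)) cΛ j) (tabs.M j) ν y') Lc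
              (SpureSymOf tabs ((Lc : ℝ) ^ 4) (-((Lc : ℝ) ^ 8 / 2)) cΛ j) (tabs.M j) μ y) +
          (mixOfK (Gsym (d := 3) Lc j) Lc (M2Of 3 Lc tabs.mixFF j) ν y' μ y + mixOfK (Gsym (d := 3) Lc j) Lc (M2Of 3 Lc tabs.mixFF j) μ y ν y' +
            dM (K2OfK (Gsym (d := 3) Lc j) Lc (SpureSymOf tabs ((Lc : ℝ) ^ 4) (-((Lc : ℝ) ^ 8 / 2)) cΛ j) (tabs.M j) μ y) Lc
              (SpureSymOf tabs ((Lc : ℝ) ^ 4) (-((Lc : ℝ) ^ 8 / 2)) cΛ j) (tabs.M j) ν y'))) :=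
  funext fun μ => funext fun y => funext fun ν => funext fun y' =>
    JsB12Sym_W_eq_vertex2OfK_add_dressed_rest hLc Ncol tabs cΛ cB j μ y ν y'

/-- [our object] **THE LITERAL's RESCALED SECOND-ORDER SLOT = BI-VERTEX THROUGH THE RESCALED UNDRESSED LEG OF THE RESCALED SYMMETRISED TWICE-PROJECTED DRESSED
BI-STENCIL + RESCALED DRESSED REST** (any nonzero units `sf`, `sm`; the owner's `BiVertexLimit.unitW_vertex2OfK` + `unitW_add'`):
`unitW sf sm (JsB12Sym … j).W = vertex2OfK (unitK sf sm (KInvStep Lc j)) Lc (unitS₂ sf sm (½•(T̂2_j + T̂2_jᵀ))) + unitW sf sm X_j` — the member-`j` shape that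
`BiVertexLimit.limTabOf_split_of_rates` consumes (at `sf := sfStep Lc j`, `sm := smStep 3 Lc j`; the rates of `unitK_j (KInvStep Lc j) → KPerf … 1` are gan24's
theorem, those of the bi-stencils and the convergence of the rest are EXT). -/
theorem unitW_JsB12Sym_W_eq (j : ℕ) {sf sm : ℝ} (hsf : sf ≠ 0) (hsm : sm ≠ 0) :
    unitW sf sm (JsB12Sym hLc Ncol tabs cΛ cB j).W =
      vertex2OfK (unitK sf sm (KInvStep (d := 3) Lc j)) Lc (unitS₂ sf sm ((1 / 2 : ℝ) •
        ((fun κ u κ' u' => dressKSymAt (toSite (ctrOff (3 + 1) Lc)) Lc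
            (coProjSymAtK (toSite (ctrOff (3 + 1) Lc)) Lc (fun κ'' u'' => coProjSymAtK (toSite (ctrOff (3 + 1) Lc)) Lc (fun β w =>
              T2RecOf 3 Lc (Gsym Lc) (SpureSymOf tabs ((Lc : ℝ) ^ 4) (-((Lc : ℝ) ^ 8 / 2)) cΛ) tabs.M ((Lc : ℝ) ^ 8) cB
                ((8 * (Ncol : ℝ) ^ 2)⁻¹ • wsym22 Ncol) tabs.vh₂S tabs.mixFF j β w κ'' u'') κ u) κ' u')) +
          (fun κ u κ' u' => dressKSymAt (toSite (ctrOff (3 + 1) Lc)) Lc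
            (coProjSymAtK (toSite (ctrOff (3 + 1) Lc)) Lc (fun κ'' u'' => coProjSymAtK (toSite (ctrOff (3 + 1) Lc)) Lc (fun β w =>
              T2RecOf 3 Lc (Gsym Lc) (SpureSymOf tabs ((Lc : ℝ) ^ 4) (-((Lc : ℝ) ^ 8 / 2)) cΛ) tabs.M ((Lc : ℝ) ^ 8) cB
                ((8 * (Ncol : ℝ) ^ 2)⁻¹ • wsym22 Ncol) tabs.vh₂S tabs.mixFF j β w κ'' u'') κ' u') κ u))))) +
      unitW sf sm (fun μ y ν y' => dressKSymAt (toSite (ctrOff (3 + 1) Lc)) Lc ((1 / 2 : ℝ) •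
        ((mixOfK (Gsym (d := 3) Lc j) Lc (M2Of 3 Lc tabs.mixFF j) μ y ν y' + mixOfK (Gsym (d := 3) Lc j) Lc (M2Of 3 Lc tabs.mixFF j) ν y' μ y +
            dM (K2OfK (Gsym (d := 3) Lc j) Lc (SpureSymOf tabs ((Lc : ℝ) ^ 4) (-((Lc : ℝ) ^ 8 / 2)) cΛ j) (tabs.M j) ν y') Lc
              (SpureSymOf tabs ((Lc : ℝ) ^ 4) (-((Lc : ℝ) ^ 8 / 2)) cΛ j) (tabs.M j) μ y) +
          (mixOfK (Gsym (d := 3) Lc j) Lc (M2Of 3 Lc tabs.mixFF j) ν y' μ y + mixOfK (Gsym (d := 3) Lc j) Lc (M2Of 3 Lc tabs.mixFF j) μ y ν y' +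
            dM (K2OfK (Gsym (d := 3) Lc j) Lc (SpureSymOf tabs ((Lc : ℝ) ^ 4) (-((Lc : ℝ) ^ 8 / 2)) cΛ j) (tabs.M j) μ y) Lc
              (SpureSymOf tabs ((Lc : ℝ) ^ 4) (-((Lc : ℝ) ^ 8 / 2)) cΛ j) (tabs.M j) ν y')))) := by
  rw [JsB12Sym_W_eq_vertex2OfK_add_dressed_rest_fam hLc Ncol tabs cΛ cB j, unitW_add', unitW_vertex2OfK hsf hsm]

end Literal

end Summit.QuantumFields.BalabanUV.Beta.FP.BiVertexDressSymLiteral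

end
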